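import Mathlib.RingTheory.PowerSeries.WeierstrassPreparation
import Mathlib.RingTheory.AdjoinRoot
import Mathlib.LinearAlgebra.TensorProduct.RightExactness
import Mathlib.Algebra.Module.Torsion.Basic
import Summits.BirchSwinnertonDyer.BirchSwinnertonDyer.Theorems.ResidualThetaTransportAtTwoLambdaLowerBoundO
import HarnessLib

/-!
# The crux's analytic exponent `d` IS a λ-invariant: `dim_E (E ⊗_𝒪 𝒪⟦T⟧/(L)) = d` for the
# norm-λ index `d` of `L ∈ 𝒪⟦T⟧` (Weierstrass preparation over the complete DVR `𝒪 = 𝒪_E`)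

Route `ResidualThetaTransportAtTwo` (RTT), crux (R≥)ᵖ `ResidualThetaCountLowerPureAtTwo`
(stmt-BirchSwinnertonDyer-26074); seat `prover-bsd-wall-rtt-p2` g11 (`--supports`, closes nothing).
HONEST FRAMING: THEOREMS ONLY (no definition, no named fact, no instance, no `sorry`); pure commutative
algebra; BSD is not proved by any of this.

WHY (memo `Cruxes/ResidualThetaCountLowerPureAtTwo/LINE-DESIGN-g11.md` §2 (f)/(g)). The crux binds its
exponent `d` by the two NORM clauses `∀ k, ‖L⁻_k‖ ≤ ‖L⁻_d‖` and `∀ k < d, ‖L⁻_k‖ < ‖L⁻_d‖` on the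
coefficients of the Pollack-pair member `Lm ∈ 𝒪⟦T⟧` read in `ℚ̄₂` ("norm-language λ-invariant"; a
witness exists for every `Lm ≠ 0`: `ResidualThetaLayer.stub_normLambdaWitnessAtTwo`). Every CM-endpoint
line must identify this `d` with the MODULE-THEORETIC λ-invariant of `Λ_𝒪/(Lm)` that the main
conjecture speaks about. This file proves exactly that, in the λ-currency of the companion files
`…LambdaLowerBoundO[Algebra]` (`λ_𝒪(X) = dim_E(E ⊗_𝒪 X)`):

* `dvd_of_norm_le` — in `𝒪_E`, `‖x‖ ≤ ‖y‖`, `y ≠ 0` ⇒ `y ∣ x`;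
* `exists_eq_C_mul_of_normLambda` — the binders at `d` factor `L = C(c)·L₀` with `c = L_d ≠ 0`,
  `(L₀)_d = 1` and `(L₀)_k ∈ 𝔪` for `k < d`, so `ord(L₀ mod 𝔪) = d` (`order_map_residue_eq`);
* `free_quotient_span_of_order_eq` / `finrank_quotient_span_of_order_eq` — for `L₀` with
  `ord(L₀ mod 𝔪) = d`: `𝒪⟦T⟧/(L₀)` is free of rank `d` over `𝒪` (Weierstrass preparation
  `L₀ = f·u`, `f` distinguished of degree `d`, Mathlib `IsWeierstrassFactorization.algEquivQuotient`,
  and the power basis of `𝒪[T]/(f)`), using `isAdicComplete_maximalIdeal_unitBall`;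
* `finrank_baseChange_eq_of_surjective_of_smul_ker_eq_zero` — `dim_K(K ⊗ M) = dim_K(K ⊗ N)` along a
  surjection whose kernel is killed by an element invertible in `K`;
* **`finrank_baseChange_quotient_span_eq_of_normLambda`** — `dim_E(E ⊗_𝒪 𝒪⟦T⟧/(L)) = d` for every
  `L ≠ 0` with the two norm binders at `d` (any `μ`: the factor `C(c)` is `E`-invisible);
  **`finrank_quotientTorsion_quotient_span_eq_of_normLambda`** — the intrinsic form
  `rank_𝒪((𝒪⟦T⟧/(L))/torsion) = d` (torsion = the kernel onto `𝒪⟦T⟧/(L₀)`);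
* §3 **`finrank_quotientTorsion_quotient_span_eq_of_normLambda_iwasawaAlgebraO`** — the same on the
  crux's own carriers `padicCoeffIntegers S`, `IwasawaAlgebraO S`, with the crux's LITERAL binders on
  `iwasawaOToPowerSeries S Lm` (transport along `padicCoeffIntegers_eq_unitBall`).

References: [Washington1997] §7.1 Prop. 7.2 / Thm. 7.3 (Weierstrass division and preparation), §13.2.
-/

set_option autoImplicit false
-- the Theorems namespace of this sub repeats the summit name by design (D-0017 nested layout)
set_option linter.dupNamespace false

noncomputable section

open scoped TensorProduct

namespace Summit.BirchSwinnertonDyer.BirchSwinnertonDyer.Theorems.LambdaLowerBoundO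

universe u v w

/-! ### §1. A base-change rank lemma -/

section BaseChange

variable {R : Type u} [CommRing R] (K : Type v) [Field K] [Algebra R K]

/-- **`dim_K(K ⊗ M) = dim_K(K ⊗ N)` along a surjection `M → N` whose kernel is killed by some `c ∈ R`
that becomes a unit in `K`** (`K ⊗ ker = 0` and right exactness). [folklore] -/
theorem finrank_baseChange_eq_of_surjective_of_smul_ker_eq_zero {M : Type w} {N : Type w}
    [AddCommGroup M] [Module R M] [AddCommGroup N] [Module R N] (f : M →ₗ[R] N)
    (hf : Function.Surjective f) (c : R) (hc : IsUnit (algebraMap R K c))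
    (hker : ∀ x ∈ LinearMap.ker f, c • x = 0) :
    Module.finrank K (K ⊗[R] M) = Module.finrank K (K ⊗[R] N) := by
  have hexact := lTensor_exact K (LinearMap.exact_subtype_ker_map f) hf
  have hsurj : Function.Surjective (f.lTensor K) := LinearMap.lTensor_surjective K hf
  have hzero : ∀ z : K ⊗[R] (LinearMap.ker f), z = 0 := by
    intro z
    induction z using TensorProduct.induction_on with
    | zero => rfl
    | tmul q t =>
      have hq : q = c • (q * hc.unit⁻¹.1) := by
        rw [Algebra.smul_def, mul_left_comm, IsUnit.mul_val_inv, mul_one]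
      have hct : c • t = 0 := by
        apply Subtype.ext
        change c • (t : M) = 0
        exact hker t t.2
      rw [hq, TensorProduct.smul_tmul, hct, TensorProduct.tmul_zero]
    | add x y hx hy => rw [hx, hy, add_zero]
  have hinj : Function.Injective (f.lTensor K) := by
    rw [← LinearMap.ker_eq_bot, LinearMap.exact_iff.mp hexact, LinearMap.range_eq_bot]
    refine LinearMap.ext fun z => ?_
    rw [hzero z, map_zero, LinearMap.zero_apply]
  have hbij : Function.Bijective (f.baseChange K) := by
    rw [Function.Bijective, LinearMap.baseChange_eq_ltensor]
    exact ⟨hinj, hsurj⟩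
  exact (LinearEquiv.ofBijective _ hbij).finrank_eq

end BaseChange

/-! ### §2. Norm-λ data over `𝒪_E` -/

section UnitBall

open Literature.NumberTheory.Automorphic PowerSeries

variable (p : ℕ) [Fact p.Prime] (E : IntermediateField ℚ_[p] (PadicAlgCl p))

/-- In `𝒪_E ⊂ ℚ̄_p`: `‖x‖ ≤ ‖y‖` and `y ≠ 0` imply `y ∣ x` (`x/y` lies in the unit ball). [folklore] -/
theorem dvd_of_norm_le {x y : PadicIntermediateField.unitBall p E}
    (h : ‖(x : PadicAlgCl p)‖ ≤ ‖(y : PadicAlgCl p)‖) (hy : y ≠ 0) : y ∣ x := by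
  have hy' : (y : PadicAlgCl p) ≠ 0 := fun h0 => hy (Subtype.ext h0)
  refine ⟨⟨(x : PadicAlgCl p) / y, (PadicIntermediateField.mem_unitBall_iff p E).2 ⟨?_, ?_⟩⟩,
    Subtype.ext ?_⟩
  · exact div_mem (PadicIntermediateField.mem_of_mem_unitBall p E x.2)
      (PadicIntermediateField.mem_of_mem_unitBall p E y.2)
  · rw [map_div₀, PadicAlgCl.valuation_def, PadicAlgCl.valuation_def]
    have : ‖(x : PadicAlgCl p)‖₊ ≤ ‖(y : PadicAlgCl p)‖₊ := h
    exact div_le_one_of_le₀ this zero_le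
  · rw [Subring.coe_mul]
    exact (mul_div_cancel₀ _ hy').symm

/-- Units of `𝒪_E` have norm `1`; elements of norm `< 1` are not units. [folklore] -/
theorem norm_lt_one_iff_not_isUnit (x : PadicIntermediateField.unitBall p E) :
    ‖(x : PadicAlgCl p)‖ < 1 ↔ ¬ IsUnit x := by
  constructor
  · intro h hu
    have h1 := PadicIntermediateField.valued_eq_one_of_isUnit p E hu
    rw [PadicAlgCl.valuation_def] at h1
    have : ‖(x : PadicAlgCl p)‖ = 1 := by rw [← coe_nnnorm, h1, NNReal.coe_one]
    exact h.ne this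
  · intro h
    have hle : Valued.v (x : PadicAlgCl p) ≤ 1 := PadicIntermediateField.valued_le_one_of_mem_unitBall p E x.2
    have hne : Valued.v (x : PadicAlgCl p) ≠ 1 := fun h1 =>
      h (PadicIntermediateField.isUnit_of_valued_eq_one p E h1)
    have hlt : Valued.v (x : PadicAlgCl p) < 1 := lt_of_le_of_ne hle hne
    rw [PadicAlgCl.valuation_def] at hlt
    exact_mod_cast hlt

/-- **Factoring out the `d`-th coefficient.** If `L ∈ 𝒪_E⟦T⟧` is non-zero and `d` satisfies the two
norm binders of the crux (`‖L_k‖ ≤ ‖L_d‖` for all `k`, `<` for `k < d`), then `L = C(L_d)·L₀` with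
`L_d ≠ 0`, `(L₀)_d = 1` and `(L₀)_k ∈ 𝔪` for `k < d`. [folklore] -/
theorem exists_eq_C_mul_of_normLambda (L : PowerSeries (PadicIntermediateField.unitBall p E)) (d : ℕ)
    (hL : L ≠ 0)
    (hle : ∀ k, ‖((coeff k L : PadicIntermediateField.unitBall p E) : PadicAlgCl p)‖ ≤
      ‖((coeff d L : PadicIntermediateField.unitBall p E) : PadicAlgCl p)‖)
    (hlt : ∀ k, k < d → ‖((coeff k L : PadicIntermediateField.unitBall p E) : PadicAlgCl p)‖ <
      ‖((coeff d L : PadicIntermediateField.unitBall p E) : PadicAlgCl p)‖) :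
    ∃ L₀ : PowerSeries (PadicIntermediateField.unitBall p E),
      L = C (coeff d L) * L₀ ∧ coeff d L ≠ 0 ∧ coeff d L₀ = 1 ∧
        ∀ k, k < d → coeff k L₀ ∈ IsLocalRing.maximalIdeal (PadicIntermediateField.unitBall p E) := by
  set c := coeff d L with hc
  have hc0 : c ≠ 0 := by
    intro h0
    apply hL
    refine PowerSeries.ext fun k => ?_
    have hk := hle k
    rw [h0, ZeroMemClass.coe_zero, norm_zero, norm_le_zero_iff] at hk
    rw [map_zero]
    exact_mod_cast hk
  have hdvd : ∀ k, c ∣ coeff k L := fun k => dvd_of_norm_le p E (hle k) hc0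
  choose q hq using hdvd
  refine ⟨PowerSeries.mk q, ?_, hc0, ?_, fun k hk => ?_⟩
  · refine PowerSeries.ext fun k => ?_
    rw [coeff_C_mul, coeff_mk]
    exact hq k
  · rw [coeff_mk]
    have h := hq d
    rw [← hc] at h
    exact (mul_right_injective₀ hc0 (h.symm.trans (mul_one c).symm))
  · rw [coeff_mk, IsLocalRing.mem_maximalIdeal, mem_nonunits_iff, ← norm_lt_one_iff_not_isUnit]
    have h := hlt k hk
    rw [hq k, Subring.coe_mul, norm_mul] at h
    have hcpos : 0 < ‖(c : PadicAlgCl p)‖ := norm_pos_iff.2 fun h0 => hc0 (Subtype.ext h0)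
    exact (mul_lt_iff_lt_one_right hcpos).1 h

/-- `ord(L₀ mod 𝔪) = d` when `(L₀)_d = 1` and `(L₀)_k ∈ 𝔪` for `k < d`. [folklore] -/
theorem order_map_residue_eq {O : Type u} [CommRing O] [IsLocalRing O] (L₀ : PowerSeries O) (d : ℕ)
    (hd : coeff d L₀ = 1) (hlt : ∀ k, k < d → coeff k L₀ ∈ IsLocalRing.maximalIdeal O) :
    (L₀.map (IsLocalRing.residue O)).order = d := by
  rw [order_eq_nat]
  refine ⟨?_, fun k hk => ?_⟩
  · rw [coeff_map, hd, map_one]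
    exact one_ne_zero
  · rw [coeff_map, IsLocalRing.residue_eq_zero_iff]
    exact hlt k hk

variable [FiniteDimensional ℚ_[p] E]

/-- **`𝒪_E⟦T⟧/(L₀)` is free of rank `d` over `𝒪_E` when `ord(L₀ mod 𝔪) = d`** (Weierstrass preparation
over the complete local ring `𝒪_E`: `L₀ = f·u` with `f` distinguished of degree `d`, and
`𝒪[T]/(f) ≅ 𝒪⟦T⟧/(L₀)` has the power basis `1, T, …, T^{d-1}`).
[cite: Washington1997, §7.1 Thm. 7.3] -/
theorem free_finrank_quotient_span_of_order_eq (L₀ : PowerSeries (PadicIntermediateField.unitBall p E))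
    (d : ℕ) (hord : (L₀.map (IsLocalRing.residue (PadicIntermediateField.unitBall p E))).order = d) :
    Module.Free (PadicIntermediateField.unitBall p E)
        (PowerSeries (PadicIntermediateField.unitBall p E) ⧸ Ideal.span {L₀}) ∧
      Module.Finite (PadicIntermediateField.unitBall p E)
        (PowerSeries (PadicIntermediateField.unitBall p E) ⧸ Ideal.span {L₀}) ∧
      Module.finrank (PadicIntermediateField.unitBall p E)
        (PowerSeries (PadicIntermediateField.unitBall p E) ⧸ Ideal.span {L₀}) = d := by
  haveI := isAdicComplete_maximalIdeal_unitBall p E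
  have hne : L₀.map (IsLocalRing.residue (PadicIntermediateField.unitBall p E)) ≠ 0 := by
    intro h0
    rw [h0, order_zero] at hord
    exact ENat.top_ne_coe d hord
  obtain ⟨f, h, H⟩ := exists_isWeierstrassFactorization hne
  have hdeg : f.natDegree = d := by
    rw [H.natDegree_eq_toNat_order_map, hord, ENat.toNat_coe]
  -- `AdjoinRoot f = 𝒪[X]/(f)` is free of rank `d`
  let pb := AdjoinRoot.powerBasis' H.isDistinguishedAt.monic
  have hdim : pb.dim = d := by rw [AdjoinRoot.powerBasis'_dim, hdeg]
  let e := H.algEquivQuotient.toLinearEquiv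
  haveI : Module.Free (PadicIntermediateField.unitBall p E)
      (Polynomial (PadicIntermediateField.unitBall p E) ⧸ Ideal.span {f}) :=
    (Module.Free.of_basis pb.basis : Module.Free _ (AdjoinRoot f))
  haveI : Module.Finite (PadicIntermediateField.unitBall p E)
      (Polynomial (PadicIntermediateField.unitBall p E) ⧸ Ideal.span {f}) :=
    (Module.Finite.of_basis pb.basis : Module.Finite _ (AdjoinRoot f))
  refine ⟨Module.Free.of_equiv e, Module.Finite.equiv e, ?_⟩
  rw [← e.finrank_eq]
  change Module.finrank (PadicIntermediateField.unitBall p E) (AdjoinRoot f) = d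
  rw [pb.finrank, hdim]

/-- **The crux's `d` is the λ-invariant of `Λ_𝒪/(L)`**: for `L ∈ 𝒪_E⟦T⟧`, `L ≠ 0`, and `d` satisfying
the two norm binders, `dim_E (E ⊗_{𝒪_E} 𝒪_E⟦T⟧/(L)) = d` — whatever the `μ`-invariant of `L`
(`L = C(c)·L₀` and the kernel `(L₀)/(L) ≅ 𝒪⟦T⟧/(c)` of `𝒪⟦T⟧/(L) → 𝒪⟦T⟧/(L₀)` is killed by `c`).
[cite: Washington1997, §7.1 Thm. 7.3 and §13.2] -/
theorem finrank_baseChange_quotient_span_eq_of_normLambda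
    (L : PowerSeries (PadicIntermediateField.unitBall p E)) (d : ℕ) (hL : L ≠ 0)
    (hle : ∀ k, ‖((coeff k L : PadicIntermediateField.unitBall p E) : PadicAlgCl p)‖ ≤
      ‖((coeff d L : PadicIntermediateField.unitBall p E) : PadicAlgCl p)‖)
    (hlt : ∀ k, k < d → ‖((coeff k L : PadicIntermediateField.unitBall p E) : PadicAlgCl p)‖ <
      ‖((coeff d L : PadicIntermediateField.unitBall p E) : PadicAlgCl p)‖) :
    Module.finrank E (E ⊗[PadicIntermediateField.unitBall p E]
      (PowerSeries (PadicIntermediateField.unitBall p E) ⧸ Ideal.span {L})) = d := by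
  obtain ⟨L₀, hfac, hc0, hd1, hlow⟩ := exists_eq_C_mul_of_normLambda p E L d hL hle hlt
  set c := coeff d L with hc
  obtain ⟨hfree, hfin, hrank⟩ :=
    free_finrank_quotient_span_of_order_eq p E L₀ d (order_map_residue_eq L₀ d hd1 hlow)
  haveI := hfree
  haveI := hfin
  -- the surjection `Λ/(L) → Λ/(L₀)` and its `c`-torsion kernel
  have hle' : Ideal.span {L} ≤ Ideal.span {L₀} := by
    rw [Ideal.span_singleton_le_span_singleton, hfac]
    exact Dvd.intro_left _ rfl
  let π : (PowerSeries (PadicIntermediateField.unitBall p E) ⧸ Ideal.span {L}) →ₐ[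
      PadicIntermediateField.unitBall p E]
      (PowerSeries (PadicIntermediateField.unitBall p E) ⧸ Ideal.span {L₀}) :=
    Ideal.Quotient.factorₐ (PadicIntermediateField.unitBall p E) hle'
  have hπ : Function.Surjective π.toLinearMap := Ideal.Quotient.factor_surjective hle'
  have hker : ∀ x ∈ LinearMap.ker π.toLinearMap, c • x = 0 := by
    intro x hx
    obtain ⟨y, rfl⟩ := Ideal.Quotient.mk_surjective x
    rw [LinearMap.mem_ker, AlgHom.toLinearMap_apply, Ideal.Quotient.factorₐ_apply_mk,
      Ideal.Quotient.eq_zero_iff_mem, Ideal.mem_span_singleton'] at hx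
    obtain ⟨z, rfl⟩ := hx
    change Ideal.Quotient.mk (Ideal.span {L}) (c • (z * L₀)) = 0
    rw [Ideal.Quotient.eq_zero_iff_mem, smul_eq_C_mul, Ideal.mem_span_singleton']
    exact ⟨z, by rw [hfac]; ring⟩
  have hcE : IsUnit (algebraMap (PadicIntermediateField.unitBall p E) E c) := by
    rw [isUnit_iff_ne_zero]
    intro h0
    apply hc0
    have h1 : ((algebraMap (PadicIntermediateField.unitBall p E) E c : E) : PadicAlgCl p) = 0 := by
      rw [h0]; rfl
    rw [PadicIntermediateField.coe_algebraMap_unitBall] at h1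
    exact Subtype.ext h1
  rw [finrank_baseChange_eq_of_surjective_of_smul_ker_eq_zero E π.toLinearMap hπ c hcE hker,
    Module.finrank_baseChange, hrank]

/-- **The crux's `d` as an INTRINSIC rank**: `rank_𝒪((𝒪⟦T⟧/(L))/torsion) = d` — the torsion
submodule of `𝒪⟦T⟧/(L)` is exactly the kernel of `𝒪⟦T⟧/(L) → 𝒪⟦T⟧/(L₀)`, and the latter quotient is
free of rank `d`. (No fraction field in the statement; this is the form that transports to the crux's
carriers.) [cite: Washington1997, §7.1 Thm. 7.3 and §13.2] -/
theorem finrank_quotientTorsion_quotient_span_eq_of_normLambda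
    (L : PowerSeries (PadicIntermediateField.unitBall p E)) (d : ℕ) (hL : L ≠ 0)
    (hle : ∀ k, ‖((coeff k L : PadicIntermediateField.unitBall p E) : PadicAlgCl p)‖ ≤
      ‖((coeff d L : PadicIntermediateField.unitBall p E) : PadicAlgCl p)‖)
    (hlt : ∀ k, k < d → ‖((coeff k L : PadicIntermediateField.unitBall p E) : PadicAlgCl p)‖ <
      ‖((coeff d L : PadicIntermediateField.unitBall p E) : PadicAlgCl p)‖) :
    Module.finrank (PadicIntermediateField.unitBall p E)
      ((PowerSeries (PadicIntermediateField.unitBall p E) ⧸ Ideal.span {L}) ⧸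
        Submodule.torsion (PadicIntermediateField.unitBall p E)
          (PowerSeries (PadicIntermediateField.unitBall p E) ⧸ Ideal.span {L})) = d := by
  obtain ⟨L₀, hfac, hc0, hd1, hlow⟩ := exists_eq_C_mul_of_normLambda p E L d hL hle hlt
  set c := coeff d L with hc
  obtain ⟨hfree, hfin, hrank⟩ :=
    free_finrank_quotient_span_of_order_eq p E L₀ d (order_map_residue_eq L₀ d hd1 hlow)
  haveI := hfree
  haveI := hfin
  have hle' : Ideal.span {L} ≤ Ideal.span {L₀} := by
    rw [Ideal.span_singleton_le_span_singleton, hfac]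
    exact Dvd.intro_left _ rfl
  let π : (PowerSeries (PadicIntermediateField.unitBall p E) ⧸ Ideal.span {L}) →ₐ[
      PadicIntermediateField.unitBall p E]
      (PowerSeries (PadicIntermediateField.unitBall p E) ⧸ Ideal.span {L₀}) :=
    Ideal.Quotient.factorₐ (PadicIntermediateField.unitBall p E) hle'
  have hπ : Function.Surjective π.toLinearMap := Ideal.Quotient.factor_surjective hle'
  have hker : ∀ x ∈ LinearMap.ker π.toLinearMap, c • x = 0 := by
    intro x hx
    obtain ⟨y, rfl⟩ := Ideal.Quotient.mk_surjective x
    rw [LinearMap.mem_ker, AlgHom.toLinearMap_apply, Ideal.Quotient.factorₐ_apply_mk,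
      Ideal.Quotient.eq_zero_iff_mem, Ideal.mem_span_singleton'] at hx
    obtain ⟨z, rfl⟩ := hx
    change Ideal.Quotient.mk (Ideal.span {L}) (c • (z * L₀)) = 0
    rw [Ideal.Quotient.eq_zero_iff_mem, smul_eq_C_mul, Ideal.mem_span_singleton']
    exact ⟨z, by rw [hfac]; ring⟩
  -- torsion = kernel
  have htors : Submodule.torsion (PadicIntermediateField.unitBall p E)
      (PowerSeries (PadicIntermediateField.unitBall p E) ⧸ Ideal.span {L}) =
        LinearMap.ker π.toLinearMap := by
    refine le_antisymm (fun x hx => ?_) (fun x hx => ?_)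
    · obtain ⟨a, ha⟩ := (Submodule.mem_torsion_iff x).1 hx
      have ha0 : (a : PadicIntermediateField.unitBall p E) ≠ 0 := nonZeroDivisors.coe_ne_zero a
      rw [LinearMap.mem_ker]
      have h1 : (a : PadicIntermediateField.unitBall p E) • π.toLinearMap x = 0 := by
        rw [← LinearMap.map_smul]
        change π.toLinearMap ((a : PadicIntermediateField.unitBall p E) • x) = 0
        have : (a : PadicIntermediateField.unitBall p E) • x = 0 := ha
        rw [this, map_zero]
      exact (smul_eq_zero.1 h1).resolve_left ha0
    · exact (Submodule.mem_torsion_iff x).2 ⟨⟨c, mem_nonZeroDivisors_of_ne_zero hc0⟩, hker x hx⟩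
  let e := (Submodule.quotEquivOfEq _ _ htors).trans (π.toLinearMap.quotKerEquivOfSurjective hπ)
  rw [e.finrank_eq, hrank]

end UnitBall

/-! ### §3. The same over the crux's carriers `padicCoeffIntegers S`, `IwasawaAlgebraO S`, with the
crux's literal binders on `iwasawaOToPowerSeries S Lm` -/

section CruxCurrency

open Literature.NumberTheory.Automorphic Literature.NumberTheory.EllipticCurves PowerSeries

variable (p : ℕ) [Fact p.Prime] (S : Set (PadicAlgCl p)) [FiniteDimensional ℚ_[p] (padicCoeffField S)]

/-- **The crux's analytic exponent `d` is the λ-invariant `rank_𝒪((Λ_𝒪/(Lm))/torsion)`**, stated on the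
crux's own carriers: `𝒪 = padicCoeffIntegers S`, `Λ_𝒪 = IwasawaAlgebraO S`, norms of the coefficients of
`iwasawaOToPowerSeries S Lm` exactly as in the binders of `ResidualThetaCountLowerPureAtTwo`
(`S = Set.range ι`). [cite: Washington1997, §7.1 Thm. 7.3 and §13.2] -/
theorem finrank_quotientTorsion_quotient_span_eq_of_normLambda_iwasawaAlgebraO :
    ∀ (Lm : IwasawaAlgebraO S) (d : ℕ), Lm ≠ 0 →
      (∀ k : ℕ, ‖coeff k (iwasawaOToPowerSeries S Lm)‖ ≤ ‖coeff d (iwasawaOToPowerSeries S Lm)‖) →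
      (∀ k : ℕ, k < d → ‖coeff k (iwasawaOToPowerSeries S Lm)‖ < ‖coeff d (iwasawaOToPowerSeries S Lm)‖) →
      Module.finrank (padicCoeffIntegers S)
        ((IwasawaAlgebraO S ⧸ Ideal.span {Lm}) ⧸
          Submodule.torsion (padicCoeffIntegers S) (IwasawaAlgebraO S ⧸ Ideal.span {Lm})) = d := by
  simp only [coeff_iwasawaOToPowerSeries]
  unfold IwasawaAlgebraO
  rw [padicCoeffIntegers_eq_unitBall S]
  intro Lm d hL hle hlt
  exact finrank_quotientTorsion_quotient_span_eq_of_normLambda p (padicCoeffField S) Lm d hL hle hlt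

end CruxCurrency



end Summit.BirchSwinnertonDyer.BirchSwinnertonDyer.Theorems.LambdaLowerBoundO

end
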